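import Mathlib
import HarnessLib
import Summits.ValiantsHypothesis.ValiantsHypothesis.Theses.MonotoneRestoration
import Literature.Computability.AlgebraicComplexity.ArithCircuit
import Literature.Computability.AlgebraicComplexity.ArithCircuitProofs
import Literature.Computability.AlgebraicComplexity.MonotoneStructure
import Literature.Computability.AlgebraicComplexity.PermanentIrreducible
import Literature.ModelTheory.FiniteModelTheory.CkEquiv
import Summits.ValiantsHypothesis.ValiantsHypothesis.Theorems.MonotoneRestorationMonotoneRestorationQPCosetCount
import Summits.ValiantsHypothesis.ValiantsHypothesis.Theorems.MonotoneRestorationMonotoneRestorationQPSymmetricLB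
import Summits.ValiantsHypothesis.ValiantsHypothesis.Theorems.MonotoneRestorationMonotoneRestorationQPSupportSymmetrisation
import Summits.ValiantsHypothesis.ValiantsHypothesis.Theorems.MonotoneRestorationMonotoneRestorationQPSparseRegime
import Summits.ValiantsHypothesis.ValiantsHypothesis.Theorems.MonotoneRestorationMonotoneRestorationQPBeta
import Literature.Computability.AlgebraicComplexity.SymmetricArithCircuit
import Literature.Computability.AlgebraicComplexity.DawarWilsenach2025Proofs
import Literature.GroupTheory.PermutationGroups.SmallIndexSubgroups
import Summits.ValiantsHypothesis.ValiantsHypothesis.Theorems.MonotoneRestorationQP.Negative.LoadBearing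
import Summits.ValiantsHypothesis.ValiantsHypothesis.Theorems.MonotoneRestorationMonotoneRestorationQPPermSupportCount

/-! TTRL-lite variant V19017 of stmt-ValiantsHypothesis-15886 -/

-- `Summit.ValiantsHypothesis.ValiantsHypothesis.…` is the tree's mandated single-conjunct layout
-- (Sub = Summit), so the duplicated namespace component is intended.
set_option linter.dupNamespace false

namespace Summit.ValiantsHypothesis.ValiantsHypothesis.Theorems

open Summit.ValiantsHypothesis.ValiantsHypothesis.Theses.MonotoneRestoration
open Literature.Computability.AlgebraicComplexity

/-- Scalar weights cost one plain gate: appending the product gate `prod [const c, P.output]` to a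
monotone computation `P` of `f` yields a monotone computation of `c • f` (fan-in two, plain, and
computing `C c * P.eval`; this holds even when `P.output` is a junk reference, since the new gate
reads `P.output` against the same value list as `P` does). TTRL-lite variant V19017 of
`stub_monotoneComputation_of_complexity`. -/
theorem stub_monotoneComputation_of_complexity_var19017 :
    ∀ (σ : Type) (P : ArithCircuit NNReal σ) (f : MvPolynomial σ NNReal) (c : NNReal),
      Literature.Barriers.ValiantsHypothesis.IsMonotoneComputation P f →
      Literature.Barriers.ValiantsHypothesis.IsMonotoneComputation
        (⟨P.gates ++ [ArithCircuit.Gate.prod [ArithCircuit.Operand.const c, P.output]],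
          ArithCircuit.Operand.gate P.size⟩ : ArithCircuit NNReal σ) (c • f) := by
  intro σ P f c hP
  obtain ⟨hfan, hplain, hcomp⟩ := hP
  refine ⟨?_, ?_, ?_⟩
  · intro g hg
    simp only [List.mem_append, List.mem_singleton] at hg
    rcases hg with hg | rfl
    · exact hfan g hg
    · simp [ArithCircuit.Gate.fanIn, ArithCircuit.Gate.args]
  · intro g hg
    simp only [List.mem_append, List.mem_singleton] at hg
    rcases hg with hg | rfl
    · exact hplain g hg
    · exact Literature.Barriers.ValiantsHypothesis.isPlainGate_prod _
  · have h := ArithCircuit.gateValues_length (k := NNReal) P.gates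
    unfold ArithCircuit.Computes ArithCircuit.eval at hcomp ⊢
    simp only [ArithCircuit.gateValues_append_singleton, ArithCircuit.Gate.eval, List.map_cons,
      List.map_nil, List.prod_cons, List.prod_nil, hcomp]
    simp [ArithCircuit.Operand.eval, ArithCircuit.size, List.getD_eq_getElem?_getD, h,
      MvPolynomial.smul_eq_C_mul]

end Summit.ValiantsHypothesis.ValiantsHypothesis.Theorems
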